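import Summits.SmoothPoincare4.SmoothPoincare4.Theses.EntropyRung
import Summits.SmoothPoincare4.SmoothPoincare4.Theorems.EntropyRungSubcylindricalExistenceSphereChart
import Summits.SmoothPoincare4.SmoothPoincare4.Theorems.EntropyRungSubcylindricalExistenceSphereHeight
import Summits.SmoothPoincare4.SmoothPoincare4.Theorems.EntropyRungSubcylindricalExistenceConcaveRamp
import Summits.SmoothPoincare4.SmoothPoincare4.Theorems.EntropyRungSubcylindricalExistenceSphereGreenRound
import Summits.SmoothPoincare4.SmoothPoincare4.Theorems.EntropyRungSubcylindricalExistenceSphereWarpedFactor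
import Summits.SmoothPoincare4.SmoothPoincare4.Theorems.EntropyRungSubcylindricalExistenceSphereWarpedRealisation
import Summits.SmoothPoincare4.SmoothPoincare4.Theorems.EntropyRungSubcylindricalExistenceSphereGreenWarped
import Summits.SmoothPoincare4.SmoothPoincare4.Theorems.EntropyRungSubcylindricalExistenceSphereConePair
import Summits.SmoothPoincare4.SmoothPoincare4.Theorems.EntropyRungSubcylindricalExistenceSphereConeMetric
import Literature.Geometry.Riemannian.SharpLogSobolevAVRFlat
import Literature.Geometry.Riemannian.RoundSphereProofs
import Literature.Geometry.Riemannian.AubinYamabeSphereEuclidean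
import HarnessLib

/-!
# The `S⁴` instance of the transfer stub T of line `fat-conical-core-avr-logsobolev`
# (crux `EntropyRung.SubcylindricalExistence`, stmt-SmoothPoincare4-10871; lead c5, cycle 2)

The transfer stub T `stub_coneCoreExistence` (lead c4, reshape R-c4) asks every closed smooth homotopy
4-sphere `M` for: a metric `g` EUCLIDEAN in the atlas chart at `p` on a closed ball of radius `r`, a CONE
FACTOR `Λ`, smooth and positive on `{p}ᶜ`, equal to `c‖y − φp‖^(−(c+1))` on the punctured ball, and a
complete `Ric ≥ 0` core `(P, h)` of AVR `c³ > Θ(S³×ℝ) = 2√π e^(−3/2)` identified with `({p}ᶜ, Λ²g)` by an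
explicit inverse pair `ι : P → M`, `σ : M → P` with `h = ι^*(Λ²g)`. It is SPC4-hard given the rung (and
BKT); it had never been instantiated.

`helper_coneCoreExistence_sphereFour` is T's body at `M = S⁴` with `c = 1`, `r = 2`: `g = W² g_S` is the
witness metric of the sibling transfer stub Â_b (`helper_sphereWarpedRealisation` ∘ `helper_sphereWarpedFactor`
∘ `helper_concaveRamp`, flat on the chart ball `‖y‖ ≤ 2` at `p`), `Λ := G/4` with `G = G_S/W` its Green
function (`helper_sphereGreenWarped`: `G = 4/‖y‖²` on the ball, so `Λ = ‖y‖⁻² = 1·‖y‖^(−(1+1))`), the core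
is flat `ℝ⁴` — `P = EuclideanSpace ℝ (Fin 4)`, `h = δ` (`euclideanMetric`) — with
`ι = φ_{−p}⁻¹ ∘ (4 • ·)` and `σ = 4⁻¹ • φ_{−p}` (`helper_sphereConePair`), for which `Λ² ι^* g = δ`
EXACTLY (`helper_sphereConeMetric`: in the chart at `−p`, `g_S = Ω² δ`, `G_S = Ω⁻¹`, `Ω(z) = 4/(‖z‖²+4)`;
both cone helpers landed: p135867, p135859);
completeness, `Ric ≥ 0` and AVR `= 1 = c³` of `(ℝ⁴, δ)` are the certified flat model of the BKT fact
(`sharpLogSobolevAVR_four_flatModel`), and `2√π e^(−3/2) < 1` is `two_sqrt_pi_lt_exp`.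
-/

noncomputable section

-- the Theorems namespace repeats a component of the summit path (as in every sibling file)
set_option linter.dupNamespace false

open scoped Manifold ContDiff Topology ENNReal NNReal ContinuousMap RealInnerProductSpace
open Set Filter Function MeasureTheory
open Literature.Geometry.Lorentzian Literature.Geometry.Riemannian

namespace Summit.SmoothPoincare4.SmoothPoincare4.Theorems

/-- **The `S⁴` instance of the transfer stub T** (`c = 1`, `r = 2`; registered helper
`helper_coneCoreExistence_sphereFour` of crux stmt-SmoothPoincare4-10871): see the module docstring. [folklore] -/
theorem helper_coneCoreExistence_sphereFour :
    ∃ g : PseudoRiemannianMetric (𝓡 4) ∞ (EuclideanSpace ℝ (Fin 4)) (TangentSpace (𝓡 4) :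
      Metric.sphere (0 : EuclideanSpace ℝ (Fin 5)) 1 → Type _), ∃ _ : g.HasLeviCivita, ∃ _ :
      g.IsRiemannian, ∃ (p : Metric.sphere (0 : EuclideanSpace ℝ (Fin 5)) 1) (r : ℝ) (Λ :
      Metric.sphere (0 : EuclideanSpace ℝ (Fin 5)) 1 → ℝ) (c : ℝ) (P : Type) (_ : TopologicalSpace
      P) (_ : T2Space P) (_ : SecondCountableTopology P) (_ : ChartedSpace (EuclideanSpace ℝ (Fin
      4)) P) (_ : IsManifold (𝓡 4) ∞ P) (_ : ConnectedSpace P) (_ : NoncompactSpace P) (_ : T3Space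
      P) (_ : MeasurableSpace P) (_ : BorelSpace P) (h : PseudoRiemannianMetric (𝓡 4) ∞
      (EuclideanSpace ℝ (Fin 4)) (TangentSpace (𝓡 4) : P → Type _)) (_ : h.HasLeviCivita) (hh :
      h.IsRiemannian) (ι : P → Metric.sphere (0 : EuclideanSpace ℝ (Fin 5)) 1) (σ : Metric.sphere (0
      : EuclideanSpace ℝ (Fin 5)) 1 → P), (Metric.closedBall (extChartAt (𝓡 4) p p) r ⊆ (extChartAt
      (𝓡 4) p).target ∧ ∀ y ∈ Metric.closedBall (extChartAt (𝓡 4) p p) r, ∀ X W : EuclideanSpace ℝ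
      (Fin 4), g.val ((extChartAt (𝓡 4) p).symm y) (mfderiv 𝓘(ℝ, EuclideanSpace ℝ (Fin 4)) (𝓡 4)
      (extChartAt (𝓡 4) p).symm y X) (mfderiv 𝓘(ℝ, EuclideanSpace ℝ (Fin 4)) (𝓡 4) (extChartAt (𝓡 4)
      p).symm y W) = ⟪X, W⟫) ∧ (ContMDiffOn (𝓡 4) 𝓘(ℝ, ℝ) ∞ Λ {p}ᶜ ∧ (∀ x, x ≠ p → 0 < Λ x) ∧ ∀ y ∈
      Metric.closedBall (extChartAt (𝓡 4) p p) r, y ≠ extChartAt (𝓡 4) p p → Λ ((extChartAt (𝓡 4)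
      p).symm y) = c * ‖y - extChartAt (𝓡 4) p p‖ ^ (-(c + 1))) ∧ (ContMDiff (𝓡 4) (𝓡 4) ∞ ι ∧
      Injective ι ∧ (∀ q : P, Injective (mfderiv (𝓡 4) (𝓡 4) ι q)) ∧ range ι = {p}ᶜ ∧ ContMDiffOn (𝓡
      4) (𝓡 4) ∞ σ {p}ᶜ ∧ (∀ q : P, σ (ι q) = q) ∧ (∀ x : Metric.sphere (0 : EuclideanSpace ℝ (Fin
      5)) 1, x ≠ p → ι (σ x) = x) ∧ ∀ (q : P) (v w : TangentSpace (𝓡 4) q), h.val q v w = Λ (ι q) ^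
      2 * g.val (ι q) (mfderiv (𝓡 4) (𝓡 4) ι q v) (mfderiv (𝓡 4) (𝓡 4) ι q w)) ∧ ((∀ (x : P) (r :
      NNReal), IsCompact {y : P | h.edist hh x y ≤ r}) ∧ (∀ (x : P) (X : TangentSpace (𝓡 4) x), 0 ≤
      h.ricci x X X) ∧ ∀ x : P, Tendsto (fun r : ℝ ↦ ((riemannianMeasure
      (h.toContMDiffRiemannianMetric hh)) {y : P | h.edist hh x y ≤ ENNReal.ofReal r}).toReal /
      (Real.pi ^ 2 / 2 * r ^ 4)) atTop (𝓝 (c ^ 3))) ∧ (0 < r ∧ 0 < c ∧ c ≤ 1) ∧ 2 * Real.sqrt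
      Real.pi * Real.exp (-(3 : ℝ) / 2) < c ^ 3 := by
  haveI hfact : Fact (Module.finrank ℝ (EuclideanSpace ℝ (Fin 5)) = 4 + 1) := ⟨finrank_euclideanSpace_fin⟩
  haveI : (@roundMetric (EuclideanSpace ℝ (Fin 5)) _ _ 4 _).HasLeviCivita :=
    (@roundMetric (EuclideanSpace ℝ (Fin 5)) _ _ 4 _).hasLeviCivita
  obtain ⟨p⟩ : Nonempty (Metric.sphere (0 : EuclideanSpace ℝ (Fin 5)) 1) :=
    (NormedSpace.sphere_nonempty.2 zero_le_one).to_subtype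
  -- the charts at `p` and at `-p`
  obtain ⟨hp0, -, -, hinner⟩ := helper_sphereChart p
  obtain ⟨-, -, -, hinner'⟩ := helper_sphereChart (-p)
  have hinnerp : ∀ z : EuclideanSpace ℝ (Fin 4),
      ⟪(((extChartAt (𝓡 4) (-p)).symm z : Metric.sphere (0 : EuclideanSpace ℝ (Fin 5)) 1) :
        EuclideanSpace ℝ (Fin 5)), (p : EuclideanSpace ℝ (Fin 5))⟫ = -((4 - ‖z‖ ^ 2) / (4 + ‖z‖ ^ 2)) := by
    intro z
    have h := hinner' z
    rw [coe_neg_sphere, inner_neg_right] at h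
    linarith
  -- the round Green functions at `p` and at `-p`
  obtain ⟨hGSs, hGSpos, hLGS, hGStend, -⟩ := helper_sphereGreenRound helper_sphereHeight p
  have hGreenN := helper_sphereGreenRound helper_sphereHeight (-p)
  have hfun : (fun x : Metric.sphere (0 : EuclideanSpace ℝ (Fin 5)) 1 ↦
      (2 / (1 - ⟪(x : EuclideanSpace ℝ (Fin 5)), ((-p : Metric.sphere (0 : EuclideanSpace ℝ (Fin 5)) 1) :
        EuclideanSpace ℝ (Fin 5))⟫))) =
      fun x : Metric.sphere (0 : EuclideanSpace ℝ (Fin 5)) 1 ↦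
        (2 / (1 + ⟪(x : EuclideanSpace ℝ (Fin 5)), (p : EuclideanSpace ℝ (Fin 5))⟫)) := by
    funext x
    rw [coe_neg_sphere, inner_neg_right, sub_neg_eq_add]
  rw [hfun] at hGreenN
  have hFfacts : ContMDiffOn (𝓡 4) 𝓘(ℝ, ℝ) ∞ (fun x : Metric.sphere (0 : EuclideanSpace ℝ (Fin 5)) 1 ↦
        (2 / (1 + ⟪(x : EuclideanSpace ℝ (Fin 5)), (p : EuclideanSpace ℝ (Fin 5))⟫))) {-p}ᶜ ∧
      (∀ x : Metric.sphere (0 : EuclideanSpace ℝ (Fin 5)) 1, x ≠ -p →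
        0 < (2 / (1 + ⟪(x : EuclideanSpace ℝ (Fin 5)), (p : EuclideanSpace ℝ (Fin 5))⟫))) ∧
      (∀ x : Metric.sphere (0 : EuclideanSpace ℝ (Fin 5)) 1, x ≠ -p →
        (@roundMetric (EuclideanSpace ℝ (Fin 5)) _ _ 4 _).scalarCurvature x *
            (2 / (1 + ⟪(x : EuclideanSpace ℝ (Fin 5)), (p : EuclideanSpace ℝ (Fin 5))⟫)) -
          6 * (@roundMetric (EuclideanSpace ℝ (Fin 5)) _ _ 4 _).dalembertian
            (fun x : Metric.sphere (0 : EuclideanSpace ℝ (Fin 5)) 1 ↦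
              (2 / (1 + ⟪(x : EuclideanSpace ℝ (Fin 5)), (p : EuclideanSpace ℝ (Fin 5))⟫))) x = 0) ∧
      Tendsto (fun x : Metric.sphere (0 : EuclideanSpace ℝ (Fin 5)) 1 ↦
        (2 / (1 + ⟪(x : EuclideanSpace ℝ (Fin 5)), (p : EuclideanSpace ℝ (Fin 5))⟫))) (𝓝[≠] (-p)) atTop ∧
      (∀ x : Metric.sphere (0 : EuclideanSpace ℝ (Fin 5)) 1, x ≠ -p →
        (@roundMetric (EuclideanSpace ℝ (Fin 5)) _ _ 4 _).gradSq
            (fun x : Metric.sphere (0 : EuclideanSpace ℝ (Fin 5)) 1 ↦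
              (2 / (1 + ⟪(x : EuclideanSpace ℝ (Fin 5)), (p : EuclideanSpace ℝ (Fin 5))⟫))) x =
          (2 / (1 + ⟪(x : EuclideanSpace ℝ (Fin 5)), (p : EuclideanSpace ℝ (Fin 5))⟫)) ^ 2 *
            ((2 / (1 + ⟪(x : EuclideanSpace ℝ (Fin 5)), (p : EuclideanSpace ℝ (Fin 5))⟫)) - 1)) := by
    obtain ⟨h1, h2, h3, h4, h5⟩ := hGreenN
    refine ⟨h1, fun x hx ↦ ?_, fun x hx ↦ ?_, h4, fun x hx ↦ ?_⟩
    · simpa only [coe_neg_sphere, inner_neg_right, sub_neg_eq_add] using h2 x hx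
    · simpa only [coe_neg_sphere, inner_neg_right, sub_neg_eq_add] using h3 x hx
    · simpa only [coe_neg_sphere, inner_neg_right, sub_neg_eq_add] using h5 x hx
  -- the ramp, the warped factor, the realisation `g = W² g_S`
  obtain ⟨θ, hθs, hθid, hθc, hθ0, hθ1, hθlt, hθcc, hθpos⟩ :=
    helper_concaveRamp (1 + (2 : ℝ) ^ 2 / 4) 3 (by norm_num) (by norm_num)
  obtain ⟨hWs, hWpos, hLW, hLW0, hWeq⟩ := helper_sphereWarpedFactor p hFfacts (1 + (2 : ℝ) ^ 2 / 4) 3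
    (by norm_num) (by norm_num) θ hθs hθid hθc hθ0 hθ1 hθlt hθcc hθpos
  obtain ⟨g, hgLC, hg, hgval, -, -, -, hball, hflat, hWball⟩ :=
    helper_sphereWarpedRealisation helper_sphereChart p 2 two_pos _ hWs hWpos hLW hLW0 hWeq
  -- the Green function `G = G_S / W` and the cone factor `Λ = G / 4`
  obtain ⟨⟨hGs, hGpos, -, -⟩, hGform⟩ := helper_sphereGreenWarped p g hg _ hWs hWpos hgval
    ⟨hGSs, hGSpos, hLGS, hGStend⟩ 2 two_pos hp0 hinner hWball
  -- the cone pair and the metric identity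
  obtain ⟨hιs, hιinj, hιimm, hιrange, hσs, hσι, hισ⟩ := helper_sphereConePair p
  have hmetric := helper_sphereConeMetric p g _ hWpos hgval hinnerp
  -- the flat model `(ℝ⁴, δ)`: complete, `Ric ≥ 0`, AVR `= 1`
  obtain ⟨hcomplete, hRic, -, hAVR, -⟩ := sharpLogSobolevAVR_four_flatModel
  haveI hLCδ : (euclideanMetric (EuclideanSpace ℝ (Fin 4))).HasLeviCivita :=
    (euclideanMetric (EuclideanSpace ℝ (Fin 4))).hasLeviCivita
  refine ⟨g, hgLC, hg, p, 2, fun x ↦ (2 / (1 - ⟪(x : EuclideanSpace ℝ (Fin 5)), (p : EuclideanSpace ℝ (Fin 5))⟫)) /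
      (if x = -p then θ 3 else θ (2 / (1 + ⟪(x : EuclideanSpace ℝ (Fin 5)), (p : EuclideanSpace ℝ (Fin 5))⟫))) / 4,
    1, EuclideanSpace ℝ (Fin 4), inferInstance, inferInstance, inferInstance, inferInstance, inferInstance,
    inferInstance, inferInstance, inferInstance, inferInstance, inferInstance,
    euclideanMetric (EuclideanSpace ℝ (Fin 4)), hLCδ, isRiemannian_euclideanMetric,
    fun u ↦ (extChartAt (𝓡 4) (-p)).symm ((4 : ℝ) • u), fun x ↦ (4 : ℝ)⁻¹ • extChartAt (𝓡 4) (-p) x,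
    ⟨hball, hflat⟩, ⟨?_, ?_, ?_⟩, ⟨hιs, hιinj, hιimm, hιrange, hσs, hσι, hισ, hmetric⟩,
    ⟨hcomplete, hRic, fun x ↦ ?_⟩, ⟨two_pos, one_pos, le_rfl⟩, ?_⟩
  · -- `Λ` smooth on `{p}ᶜ`
    exact hGs.div_const 4
  · -- `Λ > 0` off `p`
    exact fun x hx ↦ div_pos (hGpos x hx) four_pos
  · -- `Λ = ‖y‖⁻² = 1·‖y − φp‖^(−(1+1))` on the punctured ball
    intro y hy hy0
    beta_reduce
    rw [hGform y hy hy0, add_zero, one_mul]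
    have hn : 0 < ‖y - extChartAt (𝓡 4) p p‖ := norm_pos_iff.2 (sub_ne_zero.2 hy0)
    rw [show (-(1 + 1) : ℝ) = -(2 : ℝ) by norm_num, Real.rpow_neg hn.le, Real.rpow_two]
    field_simp
  · -- AVR `= 1 = 1³`
    simpa only [one_pow] using hAVR x
  · -- `2√π e^(−3/2) < 1 = 1³`
    rw [one_pow]
    have h := two_sqrt_pi_lt_exp
    have hexp : Real.exp (-(3 : ℝ) / 2) * Real.exp (3 / 2) = 1 := by
      rw [← Real.exp_add]; norm_num
    have hpos : 0 < Real.exp (-(3 : ℝ) / 2) := Real.exp_pos _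
    nlinarith [mul_lt_mul_of_pos_right h hpos]

end Summit.SmoothPoincare4.SmoothPoincare4.Theorems

end
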